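import Summits.RiemannHypothesis.RiemannHypothesis.Theorems.CCRouteAdapters
import Literature.NumberTheory.ConnesConsani2021.SpectralCertificate
import HarnessLib

/-!
# Route «ConnesConsaniSemilocal», crux K3 `WindowSpectralBound` (stmt-RiemannHypothesis-19306) — CONDITIONAL closer

RH-FREE bookkeeping of an RH-free corpus statement (cell `rh-crit/cc`; closing recipe of record cc-lead R57 (3) /
R52 (4), elaborated end-to-end by seat t7; filed by the prover seat rh-explicit-sos-filer-1 on loan, director-rh g4
07:35Z / cc-lead R71 (2)).  K3 says: for every `C²` archimedean density `G` (stated inline by the route;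
`CCRouteAdapters.windowSpectralBound_iff` identifies the inline predicate with the corpus `IsArchDensity`) some
`a₀ ∈ [0, 0.0635]` makes the window operator inequality `0 ≤ re⟪ξ, ξ − 𝐊_I ξ⟫ + a₀|⟪η₀, ξ⟫|²` hold on
`L²([−½ log 2, ½ log 2])` (Connes–Consani 2021 §6.7, Lemma 6.10 / Thm. 6.11).  t7's `SpectralCertificate` exports
exactly this shape from the named NUMERICAL fact `CC2021_section6_enclosures` (§6.4 Fact 6.1 + Lemma 6.3, the
ε₁ ≤ 1/400 enclosure, certified outside the kernel in two code-disjoint interval lineages; kernel-time certificate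
`SpectralCert.windowSpectralBound_of_L1`).  Hence the theorem below is CONDITIONAL on that one named fact
(`conditional-result`); the item closes unconditionally the hour `CC2021_section6_enclosures` is discharged.
WHAT THIS IS NOT: any claim about RH — nothing here bears on the truth of RH.
-/

-- `Summit.RiemannHypothesis.RiemannHypothesis.…` duplicates `RiemannHypothesis` BY DESIGN (D-0017).
set_option linter.dupNamespace false

namespace Summit.RiemannHypothesis.RiemannHypothesis.Theorems.CCRouteAdapters

open Literature.NumberTheory.LFunctions Literature.NumberTheory.ConnesConsani2021

/-- **K3 `WindowSpectralBound` from the §6 enclosures** (route «ConnesConsaniSemilocal», item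
stmt-RiemannHypothesis-19306), CONDITIONAL on the named fact `CC2021_section6_enclosures`: the K3 transport
`windowSpectralBound_iff` applied to t7's export `windowSpectralBound_of_section6Enclosures`. -/
theorem windowSpectralBound_of_section6 (h : CC2021_section6_enclosures) :
    Summit.RiemannHypothesis.RiemannHypothesis.Theses.ConnesConsaniSemilocal.WindowSpectralBound :=
  windowSpectralBound_iff.mpr (windowSpectralBound_of_section6Enclosures h)

end Summit.RiemannHypothesis.RiemannHypothesis.Theorems.CCRouteAdapters
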